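import Summits.QuantumFields.YangMills.Theorems.UnitScaleTiltFluctuationComparisonRegPrLiftFaceAssembly

/-!
# Route `UnitScaleTilt` — crux K1bR-pr `FluctuationComparisonRegPrL` (stmt-QuantumFields-19935, ex 19201), stub `stub_oneStepSmallLift`
# (W7 line), (L1)-table for the INTERIOR (all-`L`) pipeline: «ANSATZ T» part 1 — THE ONE-DIMENSIONAL KERNELS OF THE TENSOR LIFT
# (support file `--supports stmt-QuantumFields-19935`)

Cell `ym3-torus` (rung R3), seat `ym3-torus-p2` gen 10; source: this seat's gen-9 memo `HOME/IR-NODE.md` §16 (the tensor-product one-step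
lift `Z′ = H₁`: cubical Whitney forms corrected to EXACT block averages; `S Z′ = 0`, `F₀ + d₁Z′ = J₂ − H₂d₂`, kit j261958/j262335), re-verified
in the tree's `rowFormC`/`succOff`/`bvec`/`kvec`/`d2` conventions (gen 10, `ansatz/verify_tensor.py`: 0 mismatches over all classes, L = 3…9).

Block size `L = 2h+1`; a fine position inside a block is an OFFSET `p ∈ {0,…,2h}` (centre `p = h`, exit `p = 2h`); a 1-D kernel is a
function `X p j` = the coefficient of the coarse datum at relative coarse index `j ∈ ℤ` (all kernels here live on `j ∈ {−1,0,1}`).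
* §1 constants `ε = h(h+1)/(2L²)`, `c₀ = L/(h+1)²`, bump `b(p) = c₀(h+1−|p−h|)`; the five kernels by components (`j = −1, 0, 1`):
  `P⁰` (block-constant interpolation of 0-forms), `P¹` (1-forms on the exit bond), `J⁰` (tent − ε·b·Δ²), `J¹` (cell/L − ε·(db)·Δ₋),
  and the HOMOTOPY `h` (`h(u)(p) = (p−h)/L·u(cell) − ε b(p)·(u(y) − u(y−1))`);
* §2 `mk3` (components ↦ kernel), the fine coboundary with carry `fδ` and the coarse index difference `cΔ`, bump facts, and the
  COMPONENTWISE forms `I1a`–`I3g` of the chain identities `∂h = J¹ − P¹`, `h∂ = J⁰ − P⁰`, `∂J⁰ = J¹∂` (pointwise in the offset `p`).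

Part 1b (`…AnsatzT1DIdentities`) assembles them into **`fδ h = J¹ − P¹`**, **`cΔ h = J⁰ − P⁰`**, **`fδ J⁰ = cΔ J¹`**, **`fδ P⁰ = cΔ P¹`**,
proves the NEUTRALITY `Σ_{p ≤ 2h} h(p, j) = 0` (source of `S Z′ = 0`) and crude `ℓ¹` bounds; parts 2–3 (`…AnsatzTKernel`, `…AnsatzTRowBound`)
assemble the `d = 3` table `kzT` and its `RowMass`/`RowBound`/transverse neutrality (`λ ≤ 18/L²`, `18/L²·√L < 1` for `L ≥ 7`).
Elementary; nothing of Bałaban's is asserted.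
-/

noncomputable section

namespace Summit.QuantumFields.YangMills.Theorems.ApproxLift.AnsatzT

/-! ## §1 Constants and the five kernels by components -/

/-- `L = 2h + 1` as a real number. -/
def Lr (h : ℕ) : ℝ := 2 * (h : ℝ) + 1

/-- `ε = (L² − 1)/(8L²) = h(h+1)/(2L²)`. -/
def eps (h : ℕ) : ℝ := ((h : ℝ) * ((h : ℝ) + 1)) / (2 * Lr h ^ 2)

/-- `c₀ = L/(h+1)²` (the bump has block sum `L`). -/
def c0 (h : ℕ) : ℝ := Lr h / ((h : ℝ) + 1) ^ 2

/-- The bump `b(p) = c₀·(h + 1 − |p − h|)`: `c₀(p+1)` for `p ≤ h`, `c₀(L − p)` for `p ≥ h`. -/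
def bump (h p : ℕ) : ℝ := c0 h * (if p ≤ h then (p : ℝ) + 1 else Lr h - p)

/-- `0 < L`. -/
theorem Lr_pos (h : ℕ) : 0 < Lr h := by unfold Lr; positivity
/-- `0 ≤ ε`. -/
theorem eps_nonneg (h : ℕ) : 0 ≤ eps h := by unfold eps; have := Lr_pos h; positivity
/-- `0 < c₀`. -/
theorem c0_pos (h : ℕ) : 0 < c0 h := by unfold c0; have := Lr_pos h; positivity

/-- `ε·c₀ = h/(2L(h+1))`. -/
theorem eps_mul_c0 (h : ℕ) : eps h * c0 h = (h : ℝ) / (2 * Lr h * ((h : ℝ) + 1)) := by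
  unfold eps c0; have hL := Lr_pos h
  have h1 : (0 : ℝ) < (h : ℝ) + 1 := by positivity
  field_simp

/-- `0 ≤ ε·c₀ ≤ 1/(2L)`. -/
theorem eps_mul_c0_le (h : ℕ) : eps h * c0 h ≤ 1 / (2 * Lr h) := by
  rw [eps_mul_c0, div_le_div_iff₀ (by have := Lr_pos h; positivity) (by have := Lr_pos h; positivity)]
  have := Lr_pos h; nlinarith

/-- `0 ≤ b(p) ≤ c₀(h+1)` for `p ≤ 2h`. -/
theorem bump_bounds {h p : ℕ} (hp : p ≤ 2 * h) : 0 ≤ bump h p ∧ bump h p ≤ c0 h * ((h : ℝ) + 1) := by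
  have hc := c0_pos h
  have hp' : (p : ℝ) ≤ 2 * h := by exact_mod_cast hp
  unfold bump; split_ifs with hph
  · have : (p : ℝ) ≤ h := by exact_mod_cast hph
    exact ⟨by positivity, by nlinarith⟩
  · have : (h : ℝ) + 1 ≤ p := by exact_mod_cast (by omega : h + 1 ≤ p)
    unfold Lr at *
    exact ⟨by nlinarith, by nlinarith⟩

/-- `ε·b(p) ≤ 1/4` (indeed `≤ h/(2L) < 1/4`) for `p ≤ 2h`. -/
theorem eps_bump_le {h p : ℕ} (hp : p ≤ 2 * h) : 0 ≤ eps h * bump h p ∧ eps h * bump h p ≤ 1 / 4 := by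
  obtain ⟨b0, b1⟩ := bump_bounds hp
  have he := eps_nonneg h
  refine ⟨mul_nonneg he b0, ?_⟩
  have h1 : eps h * bump h p ≤ eps h * c0 h * ((h : ℝ) + 1) := by nlinarith
  have h2 : eps h * c0 h * ((h : ℝ) + 1) = (h : ℝ) / (2 * Lr h) := by
    rw [eps_mul_c0]; have := Lr_pos h; have : (0:ℝ) < (h:ℝ) + 1 := by positivity
    field_simp
  have h3 : (h : ℝ) / (2 * Lr h) ≤ 1 / 4 := by
    rw [div_le_div_iff₀ (by have := Lr_pos h; positivity) (by norm_num)]; unfold Lr; nlinarith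
  linarith

/-- `P⁰`: coefficient `1` at `j = 0`. -/
def P0z (_h _p : ℕ) : ℝ := 1
/-- `P¹`: coefficient `1` at `j = 0` on the exit bond `p = 2h`. -/
def P1z (h p : ℕ) : ℝ := if p = 2 * h then 1 else 0

/-- `h`, component `j = −1`: `[p < h](p−h)/L + ε b(p)`. -/
def hm (h p : ℕ) : ℝ := (if p < h then ((p : ℝ) - h) / Lr h else 0) + eps h * bump h p
/-- `h`, component `j = 0`: `[p > h](p−h)/L − ε b(p)`. -/
def hz (h p : ℕ) : ℝ := (if h < p then ((p : ℝ) - h) / Lr h else 0) - eps h * bump h p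

/-- `J⁰`, component `j = −1`: `[p < h](h−p)/L − ε b(p)`. -/
def J0m (h p : ℕ) : ℝ := (if p < h then ((h : ℝ) - p) / Lr h else 0) - eps h * bump h p
/-- `J⁰`, component `j = 0`: `1 − |p−h|/L + 2ε b(p)`. -/
def J0z (h p : ℕ) : ℝ := (if p < h then 1 + ((p : ℝ) - h) / Lr h else 1 - ((p : ℝ) - h) / Lr h) + 2 * (eps h * bump h p)
/-- `J⁰`, component `j = 1`: `[p ≥ h](p−h)/L − ε b(p)`. -/
def J0p (h p : ℕ) : ℝ := (if h ≤ p then ((p : ℝ) - h) / Lr h else 0) - eps h * bump h p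

/-- `J¹`, component `j = −1`: `1/L + εc₀` left of the centre, `−εc₀` from the centre on (incl. the exit bond). -/
def J1m (h p : ℕ) : ℝ := if p < h then 1 / Lr h + eps h * c0 h else -(eps h * c0 h)
/-- `J¹`, component `j = 0`: `−εc₀` left of the centre, `1/L + εc₀` from the centre on, `1/L + 2εc₀` on the exit bond. -/
def J1z (h p : ℕ) : ℝ := if p < h then -(eps h * c0 h) else if p = 2 * h then 1 / Lr h + 2 * (eps h * c0 h) else 1 / Lr h + eps h * c0 h
/-- `J¹`, component `j = 1`: `−εc₀` on the exit bond, else `0`. -/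
def J1p (h p : ℕ) : ℝ := if p = 2 * h then -(eps h * c0 h) else 0

/-! ## §2 Kernels, the two differences, the four chain identities -/

/-- Assemble a kernel `ℕ → ℤ → ℝ` from its three components at `j = −1, 0, 1` (zero elsewhere). -/
def mk3 (fm fz fp : ℕ → ℝ) : ℕ → ℤ → ℝ := fun p j => if j = -1 then fm p else if j = 0 then fz p else if j = 1 then fp p else 0

/-- `P⁰`. -/ def P0 (h : ℕ) : ℕ → ℤ → ℝ := mk3 (fun _ => 0) (P0z h) (fun _ => 0)
/-- `P¹`. -/ def P1 (h : ℕ) : ℕ → ℤ → ℝ := mk3 (fun _ => 0) (P1z h) (fun _ => 0)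
/-- `h`. -/ def hh (h : ℕ) : ℕ → ℤ → ℝ := mk3 (hm h) (hz h) (fun _ => 0)
/-- `J⁰`. -/ def J0 (h : ℕ) : ℕ → ℤ → ℝ := mk3 (J0m h) (J0z h) (J0p h)
/-- `J¹`. -/ def J1 (h : ℕ) : ℕ → ℤ → ℝ := mk3 (J1m h) (J1z h) (J1p h)

/-- THE FINE COBOUNDARY WITH CARRY (block size `L`): `X(p+1, j) − X(p, j)` inside, `X(0, j−1) − X(L−1, j)` on the exit bond. -/
def fδ (L : ℕ) (X : ℕ → ℤ → ℝ) : ℕ → ℤ → ℝ := fun p j => if p < L - 1 then X (p + 1) j - X p j else X 0 (j - 1) - X p j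

/-- THE COARSE INDEX DIFFERENCE (adjoint coboundary): `X(p, j−1) − X(p, j)`. -/
def cΔ (X : ℕ → ℤ → ℝ) : ℕ → ℤ → ℝ := fun p j => X p (j - 1) - X p j

/-- A kernel built by `mk3` vanishes off `{−1, 0, 1}`. -/
theorem mk3_of_ne {fm fz fp : ℕ → ℝ} {p : ℕ} {j : ℤ} (h1 : j ≠ -1) (h2 : j ≠ 0) (h3 : j ≠ 1) : mk3 fm fz fp p j = 0 := by
  simp [mk3, h1, h2, h3]

/-- Two kernels built by `mk3` agree with a third's differences iff componentwise: the `fδ` pattern inside the block. -/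
theorem fδ_mk3_of_lt {L p : ℕ} (hp : p < L - 1) (fm fz fp : ℕ → ℝ) (j : ℤ) :
    fδ L (mk3 fm fz fp) p j = mk3 (fun q => fm (q + 1) - fm q) (fun q => fz (q + 1) - fz q) (fun q => fp (q + 1) - fp q) p j := by
  unfold fδ mk3; rw [if_pos hp]; split_ifs <;> simp

/-- The `fδ` pattern on the exit bond (`p = L − 1`): components `(−X₋(p), X₋(0) − X₀(p), X₀(0) − X₊(p))` and `X₊(0)` at `j = 2`. -/
theorem fδ_mk3_last {L p : ℕ} (hp : ¬ p < L - 1) (fm fz fp : ℕ → ℝ) (j : ℤ) :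
    fδ L (mk3 fm fz fp) p j =
      (if j = -1 then -fm p else if j = 0 then fm 0 - fz p else if j = 1 then fz 0 - fp p else if j = 2 then fp 0 else 0) := by
  unfold fδ mk3; rw [if_neg hp]
  by_cases h1 : j = -1
  · subst h1; simp
  by_cases h2 : j = 0
  · subst h2; simp
  by_cases h3 : j = 1
  · subst h3; simp
  by_cases h4 : j = 2
  · subst h4; simp
  have h5 : j - 1 ≠ -1 := fun h => h2 (by omega)
  have h6 : j - 1 ≠ 0 := fun h => h3 (by omega)
  have h7 : j - 1 ≠ 1 := fun h => h4 (by omega)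
  simp [h1, h2, h3, h4, h5, h6, h7]

/-- The `cΔ` pattern: components `(−X₋, X₋ − X₀, X₀ − X₊)` and `X₊` at `j = 2`. -/
theorem cΔ_mk3 (fm fz fp : ℕ → ℝ) (p : ℕ) (j : ℤ) :
    cΔ (mk3 fm fz fp) p j =
      (if j = -1 then -fm p else if j = 0 then fm p - fz p else if j = 1 then fz p - fp p else if j = 2 then fp p else 0) := by
  unfold cΔ mk3
  by_cases h1 : j = -1
  · subst h1; simp
  by_cases h2 : j = 0
  · subst h2; simp
  by_cases h3 : j = 1
  · subst h3; simp
  by_cases h4 : j = 2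
  · subst h4; simp
  have h5 : j - 1 ≠ -1 := fun h => h2 (by omega)
  have h6 : j - 1 ≠ 0 := fun h => h3 (by omega)
  have h7 : j - 1 ≠ 1 := fun h => h4 (by omega)
  simp [h1, h2, h3, h4, h5, h6, h7]

section Identities

variable {h p : ℕ}

/-- `b(p+1) − b(p) = c₀` left of the centre. -/
theorem bump_succ_sub_of_lt (hp : p < h) : bump h (p + 1) - bump h p = c0 h := by
  unfold bump; rw [if_pos (by omega : p + 1 ≤ h), if_pos (by omega : p ≤ h)]; push_cast; ring

/-- `b(p+1) − b(p) = −c₀` from the centre on. -/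
theorem bump_succ_sub_of_ge (hp : h ≤ p) : bump h (p + 1) - bump h p = -c0 h := by
  unfold bump
  by_cases he : p = h
  · subst he; rw [if_neg (by omega), if_pos le_rfl]; unfold Lr; push_cast; ring
  · have h1 : ¬ (p + 1 ≤ h) := by omega
    have h2 : ¬ (p ≤ h) := by omega
    rw [if_neg h1, if_neg h2]; push_cast; ring

/-- `b(0) = c₀`. -/
theorem bump_zero (h : ℕ) : bump h 0 = c0 h := by unfold bump; simp
/-- `b(2h) = c₀`. -/
theorem bump_last (h : ℕ) : bump h (2 * h) = c0 h := by
  unfold bump Lr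
  by_cases h0 : h = 0
  · subst h0; simp
  · rw [if_neg (by omega)]; push_cast; ring

/-- `L ≠ 0`. -/
theorem Lr_ne (h : ℕ) : Lr h ≠ 0 := (Lr_pos h).ne'

/-! ### `h` versus `J¹` and `P¹` (the identity `J¹ − P¹ = ∂h`) -/

/-- `∂h = J¹ − P¹`, component `j = −1` inside the block. -/
theorem I1a (hp : p < 2 * h) : hm h (p + 1) - hm h p = J1m h p := by
  have _hp := hp
  unfold hm J1m
  rcases lt_trichotomy (p + 1) h with h1 | h1 | h1
  · have c1 : p < h := by omega
    have hb := bump_succ_sub_of_lt c1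
    simp only [h1, c1, if_true]; push_cast
    linear_combination (eps h) * hb
  · have c1 : p < h := by omega
    have c2 : ¬ (p + 1 < h) := by omega
    have hb := bump_succ_sub_of_lt c1
    have hc : ((h : ℕ) : ℝ) = (p : ℝ) + 1 := by exact_mod_cast h1.symm
    simp only [c1, c2, if_true, if_false]
    rw [hc]; linear_combination (eps h) * hb
  · have c1 : ¬ p < h := by omega
    have c2 : ¬ (p + 1 < h) := by omega
    have hb := bump_succ_sub_of_ge (by omega : h ≤ p)
    simp only [c1, c2, if_false]
    linear_combination (eps h) * hb

/-- `∂h = J¹ − P¹`, component `j = 0` inside the block. -/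
theorem I1b (h1 : 1 ≤ h) (hp : p < 2 * h) : hz h (p + 1) - hz h p = J1z h p := by
  have _h1 := h1; have _hp := hp
  unfold hz J1z
  rcases lt_trichotomy p h with c | c | c
  · have c1 : ¬ (h < p + 1) := by omega
    have c2 : ¬ (h < p) := by omega
    have hb := bump_succ_sub_of_lt c
    simp only [c, c1, c2, if_true, if_false]
    linear_combination (-(eps h)) * hb
  · subst c
    have c1 : p < p + 1 := by omega
    have c3 : ¬ (p = 2 * p) := by omega
    have hb := bump_succ_sub_of_ge (le_refl p)
    simp only [c1, lt_irrefl, c3, if_true, if_false]; push_cast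
    linear_combination (-(eps p)) * hb
  · have c1 : h < p + 1 := by omega
    have c2 : ¬ (p < h) := by omega
    have c3 : ¬ (p = 2 * h) := by omega
    have hb := bump_succ_sub_of_ge (by omega : h ≤ p)
    simp only [c, c1, c2, c3, if_true, if_false]; push_cast
    linear_combination (-(eps h)) * hb

/-- `∂h = J¹ − P¹` on the exit bond, component `j = −1`. -/
theorem I1c : -hm h (2 * h) = J1m h (2 * h) := by
  unfold hm J1m; have c1 : ¬ (2 * h < h) := by omega
  simp only [c1, if_false, bump_last]; ring

/-- `∂h = J¹ − P¹` on the exit bond, component `j = 0`. -/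
theorem I1d (h1 : 1 ≤ h) : hm h 0 - hz h (2 * h) = J1z h (2 * h) - 1 := by
  unfold hm hz J1z
  have c1 : 0 < h := by omega
  have c2 : h < 2 * h := by omega
  have c3 : ¬ (2 * h < h) := by omega
  simp only [c1, c2, c3, if_true, if_false, bump_zero, bump_last]
  have hL := Lr_ne h; unfold Lr at *; push_cast; field_simp; ring

/-- `∂h = J¹ − P¹` on the exit bond, component `j = 1`. -/
theorem I1e : hz h 0 = J1p h (2 * h) := by
  unfold hz J1p; have c1 : ¬ (h < 0) := by omega
  simp only [c1, if_false, if_true, bump_zero]; ring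

/-! ### `h` versus `J⁰` and `P⁰` (the identity `J⁰ − P⁰ = h∂`) -/

/-- `h∂ = J⁰ − P⁰`, component `j = −1`. -/
theorem I2a : J0m h p = -hm h p := by
  unfold J0m hm; by_cases c : p < h
  · simp only [c, if_true]; ring
  · simp only [c, if_false]; ring

/-- `h∂ = J⁰ − P⁰`, component `j = 0`. -/
theorem I2b : J0z h p - 1 = hm h p - hz h p := by
  unfold J0z hm hz
  rcases lt_trichotomy p h with c | c | c
  · have c2 : ¬ (h < p) := by omega
    simp only [c, c2, if_true, if_false]; ring
  · subst c; simp only [lt_irrefl, if_false]; ring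
  · have c2 : ¬ (p < h) := by omega
    simp only [c, c2, if_true, if_false]; ring

/-- `h∂ = J⁰ − P⁰`, component `j = 1`. -/
theorem I2c : J0p h p = hz h p := by
  unfold J0p hz
  rcases lt_trichotomy p h with c | c | c
  · have c1 : ¬ (h ≤ p) := by omega
    have c2 : ¬ (h < p) := by omega
    simp only [c1, c2, if_false]
  · subst c; simp only [le_refl, lt_irrefl, if_true, if_false]; ring
  · have c1 : h ≤ p := by omega
    simp only [c1, c, if_true]

/-! ### `J⁰` versus `J¹` (the chain-map identity `∂J⁰ = J¹∂`) -/

/-- `∂J⁰ = J¹∂`, component `j = −1` inside the block. -/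
theorem I3a (hp : p < 2 * h) : J0m h (p + 1) - J0m h p = -J1m h p := by
  have _hp := hp
  unfold J0m J1m
  rcases lt_trichotomy (p + 1) h with h1 | h1 | h1
  · have c1 : p < h := by omega
    have hb := bump_succ_sub_of_lt c1
    simp only [h1, c1, if_true]; push_cast
    linear_combination (-(eps h)) * hb
  · have c1 : p < h := by omega
    have c2 : ¬ (p + 1 < h) := by omega
    have hb := bump_succ_sub_of_lt c1
    have hc : ((h : ℕ) : ℝ) = (p : ℝ) + 1 := by exact_mod_cast h1.symm
    simp only [c1, c2, if_true, if_false]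
    rw [hc]; linear_combination (-(eps h)) * hb
  · have c1 : ¬ p < h := by omega
    have c2 : ¬ (p + 1 < h) := by omega
    have hb := bump_succ_sub_of_ge (by omega : h ≤ p)
    simp only [c1, c2, if_false]
    linear_combination (-(eps h)) * hb

/-- `∂J⁰ = J¹∂`, component `j = 0` inside the block. -/
theorem I3b (h1 : 1 ≤ h) (hp : p < 2 * h) : J0z h (p + 1) - J0z h p = J1m h p - J1z h p := by
  unfold J0z J1m J1z
  rcases lt_trichotomy (p + 1) h with c | c | c
  · have c1 : p < h := by omega
    have c2 : ¬ (p = 2 * h) := by omega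
    have hb := bump_succ_sub_of_lt c1
    simp only [c, c1, c2, if_true, if_false]; push_cast
    linear_combination (2 * eps h) * hb
  · have c1 : p < h := by omega
    have c2 : ¬ (p + 1 < h) := by omega
    have c3 : ¬ (p = 2 * h) := by omega
    have hb := bump_succ_sub_of_lt c1
    have hc : ((h : ℕ) : ℝ) = (p : ℝ) + 1 := by exact_mod_cast c.symm
    simp only [c1, c2, c3, if_true, if_false]; push_cast
    rw [hc]; linear_combination (2 * eps h) * hb
  · have c1 : ¬ (p < h) := by omega
    have c2 : ¬ (p + 1 < h) := by omega
    have c3 : ¬ (p = 2 * h) := by omega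
    have hb := bump_succ_sub_of_ge (by omega : h ≤ p)
    simp only [c1, c2, c3, if_false]; push_cast
    linear_combination (2 * eps h) * hb

/-- `∂J⁰ = J¹∂`, component `j = 1` inside the block. -/
theorem I3c (h1 : 1 ≤ h) (hp : p < 2 * h) : J0p h (p + 1) - J0p h p = J1z h p - J1p h p := by
  have _h1 := h1
  unfold J0p J1z J1p
  have c0' : ¬ (p = 2 * h) := by omega
  rcases lt_trichotomy (p + 1) h with c | c | c
  · have c1 : p < h := by omega
    have c2 : ¬ (h ≤ p + 1) := by omega
    have c3 : ¬ (h ≤ p) := by omega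
    have hb := bump_succ_sub_of_lt c1
    simp only [c1, c2, c3, c0', if_true, if_false]
    linear_combination (-(eps h)) * hb
  · have c1 : p < h := by omega
    have c2 : h ≤ p + 1 := by omega
    have c3 : ¬ (h ≤ p) := by omega
    have hb := bump_succ_sub_of_lt c1
    have hc : ((h : ℕ) : ℝ) = (p : ℝ) + 1 := by exact_mod_cast c.symm
    simp only [c1, c2, c3, c0', if_true, if_false]; push_cast
    rw [hc]; linear_combination (-(eps h)) * hb
  · have c1 : ¬ (p < h) := by omega
    have c2 : h ≤ p + 1 := by omega
    have c3 : h ≤ p := by omega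
    have hb := bump_succ_sub_of_ge c3
    simp only [c1, c2, c3, c0', if_true, if_false]; push_cast
    linear_combination (-(eps h)) * hb

/-- `∂J⁰ = J¹∂` on the exit bond, component `j = −1`. -/
theorem I3d : J0m h (2 * h) = J1m h (2 * h) := by
  unfold J0m J1m; have c1 : ¬ (2 * h < h) := by omega
  simp only [c1, if_false, bump_last]; ring

/-- `∂J⁰ = J¹∂` on the exit bond, component `j = 0`. -/
theorem I3e (h1 : 1 ≤ h) : J0m h 0 - J0z h (2 * h) = J1m h (2 * h) - J1z h (2 * h) := by
  unfold J0m J0z J1m J1z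
  have c1 : 0 < h := by omega
  have c3 : ¬ (2 * h < h) := by omega
  simp only [c1, c3, if_true, if_false, bump_zero, bump_last]
  have hL := Lr_ne h; unfold Lr at *; push_cast; field_simp; ring

/-- `∂J⁰ = J¹∂` on the exit bond, component `j = 1`. -/
theorem I3f (h1 : 1 ≤ h) : J0z h 0 - J0p h (2 * h) = J1z h (2 * h) - J1p h (2 * h) := by
  unfold J0z J0p J1z J1p
  have c1 : 0 < h := by omega
  have c2 : h ≤ 2 * h := by omega
  have c3 : ¬ (2 * h < h) := by omega
  simp only [c1, c2, c3, if_true, if_false, bump_zero, bump_last]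
  have hL := Lr_ne h; unfold Lr at *; push_cast; field_simp; ring

/-- `∂J⁰ = J¹∂` on the exit bond, component `j = 2`. -/
theorem I3g (h1 : 1 ≤ h) : J0p h 0 = J1p h (2 * h) := by
  unfold J0p J1p; have c1 : ¬ (h ≤ 0) := by omega
  simp only [c1, if_false, if_true, bump_zero]; ring

end Identities

end Summit.QuantumFields.YangMills.Theorems.ApproxLift.AnsatzT

end
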